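import Summits.NavierStokesRegularity.NavierStokesRegularity.Theorems.PoloidalWindowDoorPoloidalWindowRigidityZShockRotatingProfileFlux
import Summits.NavierStokesRegularity.NavierStokesRegularity.Theorems.PoloidalWindowDoorPoloidalWindowRigidityZShockRotatingProfileRiemannSource
import HarnessLib

/-!
# Crux K2 `PoloidalWindowRigidity` (stmt-NavierStokesRegularity-19708), line `z_shock` — R3 inhabitant census: ROTATING PATTERNS (XIX) —
# the ANGLE FIELD of the exterior characteristics: the turning rate `λ/γ(Ψ)` is of size `≲ |y|` and its angular derivative is `≲ |y|`,
# so the angle ODE `ϑ'(r) = ∓(λ/γ(Ψ))(P(r,ϑ))/r` has a bounded, uniformly Lipschitz field (the analytic input of census item F3a)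

`--supports stmt-NavierStokesRegularity-19708 --as helper` (leafhand-ns-poloidalwindowdoor-3 g10, cell decomp-ns, 2026-08-31).  Class-free,
def-free; tree files `…ZShockRotatingProfileFlux` (polar calculus), `…ZShockRotatingProfileRiemannSource` (angular chain rule) + Mathlib.
**No stub and no summit is closed by this file; Navier–Stokes regularity is NOT proved here (rung 0).**

WHY THIS FILE.  Parts XIII/XVI/XVII transport John's approximate Riemann invariants `w± = γ(Ψ)XΨ ± λΘΨ` (`λ = √((ω²|y|² − γ(Ψ))γ(Ψ))`)
of a rotating profile along the characteristic fields `X ∓ (λ/γ(Ψ))Θ` of the hyperbolic exterior.  The integral curves are the log-radius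
polar curves `Y ρ = P(e^ρ, ϑ(e^ρ))` whose angle solves, in the RADIUS variable, `ϑ'(r) = ∓(λ/γ(Ψ))(P(r, ϑ))/r` (part XVIII,
`…RotatingProfileCharacteristics`, solves it for all forward radii with the tree's global Picard–Lindelöf lemma).  This file supplies the
three analytic properties of that field Picard–Lindelöf needs, on the strict exterior `r ≥ r₀ > 0`, `γhi < ω²r₀²`, for `0 < γlo ≤ γ ≤ γhi`:

* `speed_le` — SIZE: `0 ≤ λ/γ(Ψ) ≤ |ω|‖y‖/√γlo` at every point (`λ ≤ |ω|‖y‖√γ(Ψ)`); hence `angleField_bound`: `|ϑ'| ≤ |ω|/√γlo`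
  (the growth `~ r` of the turning rate per unit log-radius is exactly the `r` of `d log r = dr/r`);
* `angleField_continuousOn` — continuity in `r` on `[r₀, ∞)`;
* `hasDerivAt_speed_angle` — on the circle of radius `r` the turning rate `α ↦ (λ/γ(Ψ))(P(r,α))` is differentiable with derivative
  `(τ(ω²r² − 2A)/(2Λ)·A − Λτ)/A²` (`A = γ(Ψ)`, `Λ = λ`, `τ = Θ(γ∘Ψ)` at `P(r,α)`; chain rule with `∂_α P = J P`);
  `angle_speed_deriv_le` — the SCALAR KERNEL: if `|τ| ≤ M` this is `≤ K₀·r` with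
  `K₀ = M·((ω² + 2γhi/r₀²)/(2√((ω² − γhi/r₀²)γlo)·γlo) + |ω|√γhi/γlo²)` (uses `Λ ≥ r√((ω² − γhi/r₀²)γlo)`, `Λ ≤ |ω| r √γhi`,
  `|ω²r² − 2A| ≤ (ω² + 2γhi/r₀²) r²`); hence `angleField_lipschitz`: ONE Lipschitz constant in the angle for all `r ≥ r₀`;
* `angular_gamma_bound` — the hypothesis `|Θ(γ∘Ψ)| ≤ M` holds with `M = L·Q` when `|γ'| ≤ L` and `|ΘΨ| ≤ Q` (part I's angular flatness
  `angularDeriv_abs_le_of_rotating` gives `Q = 2π sup|Σ∂ᵢ(γ∂ᵢΨ)|/ω²` in the class);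
* `norm_polar` — `‖P(r, α)‖ = |r|`.

Elementary real analysis; no rigidity is proved.  presearch: as part XVIII (corpus hybrid → [corpus:book:alinhac2009-hyperbolic-partial-
differential-equations p.40], textbook account of John's method; galaxy substring «approximate Riemann invariant|outgoing characteristic|rotating
wave», all stars: no relevant hit). [folklore] (John 1974 §2)
-/

noncomputable section

namespace Summit.NavierStokesRegularity.NavierStokesRegularity.Theorems.PoloidalWindowDoorPoloidalWindowRigidityZShockRotatingProfileAngleField

-- the summit and its single sub-problem share the name (CONVENTIONS §1)
set_option linter.dupNamespace false

open Set Filter Topology Metric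
open scoped NNReal
open Summit.NavierStokesRegularity.NavierStokesRegularity.Theorems.PoloidalWindowDoorPoloidalWindowRigidityZShockRotatingProfileFlux
open Summit.NavierStokesRegularity.NavierStokesRegularity.Theorems.PoloidalWindowDoorPoloidalWindowRigidityZShockRotatingProfileRiemannSource

variable {Ψ : EuclideanSpace ℝ (Fin 2) → ℝ} {γ γ' : ℝ → ℝ} {ω : ℝ}
  {J : EuclideanSpace ℝ (Fin 2) → EuclideanSpace ℝ (Fin 2)} {P : ℝ → ℝ → EuclideanSpace ℝ (Fin 2)}

/-! ### The radius of a polar point -/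

/-- `‖P(r, α)‖ = |r|` (part IV `norm_polar_le` with equality). [folklore] -/
theorem norm_polar
    (hP : ∀ r α, P r α = (r * Real.cos α) • EuclideanSpace.single (0 : Fin 2) (1 : ℝ) + (r * Real.sin α) • EuclideanSpace.single (1 : Fin 2) (1 : ℝ))
    (r α : ℝ) : ‖P r α‖ = |r| := by
  have hcs := Real.cos_sq_add_sin_sq α
  have hsq : ‖P r α‖ ^ 2 = r ^ 2 := by
    rw [EuclideanSpace.norm_eq, Real.sq_sqrt (Finset.sum_nonneg fun i _ => sq_nonneg _), Fin.sum_univ_two, Real.norm_eq_abs,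
      Real.norm_eq_abs, sq_abs, sq_abs, polar_apply_zero hP, polar_apply_one hP]
    linear_combination r ^ 2 * hcs
  rw [← Real.sqrt_sq (norm_nonneg (P r α)), hsq, Real.sqrt_sq_eq_abs]

/-! ### The scalar kernel of the Lipschitz estimate -/

/-- **Scalar kernel of the angular Lipschitz bound.**  With `γlo ≤ A ≤ γhi`, `0 < γlo`, `0 < r₀ ≤ r`, the exterior margin `γhi < ω²r₀²`,
`Λ > 0`, `Λ² = (ω²r² − A)A` and `|τ| ≤ M`, the angular derivative of the turning rate,
`τ·(ω²r² − 2A)/(2Λ)·A − Λτ` over `A²`, is bounded by `K₀ · r` with `K₀` depending only on `(M, ω, γlo, γhi, r₀)`. [folklore] -/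
theorem angle_speed_deriv_le {A Λ τ r r₀ γlo γhi M ω : ℝ} (hγlo : 0 < γlo) (hA1 : γlo ≤ A) (hA2 : A ≤ γhi)
    (hr₀ : 0 < r₀) (hr : r₀ ≤ r) (hmargin : γhi < ω ^ 2 * r₀ ^ 2) (hΛ : 0 < Λ) (hΛ2 : Λ ^ 2 = (ω ^ 2 * r ^ 2 - A) * A)
    (hτ : |τ| ≤ M) :
    |(τ * (ω ^ 2 * r ^ 2 - 2 * A) / (2 * Λ) * A - Λ * τ) / A ^ 2| ≤
      M * ((ω ^ 2 + 2 * γhi / r₀ ^ 2) / (2 * Real.sqrt ((ω ^ 2 - γhi / r₀ ^ 2) * γlo) * γlo) +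
        |ω| * Real.sqrt γhi / γlo ^ 2) * r := by
  have hApos : 0 < A := hγlo.trans_le hA1
  have hrpos : 0 < r := hr₀.trans_le hr
  have hγhi0 : 0 < γhi := hApos.trans_le hA2
  have hM0 : 0 ≤ M := (abs_nonneg τ).trans hτ
  have hr2 : r₀ ^ 2 ≤ r ^ 2 := pow_le_pow_left₀ hr₀.le hr 2
  have hr₀2 : 0 < r₀ ^ 2 := by positivity
  -- the margin constant `κ₀ = ω² − γhi/r₀² > 0`
  have hκ : 0 < ω ^ 2 - γhi / r₀ ^ 2 := by
    rw [sub_pos, div_lt_iff₀ hr₀2]; exact hmargin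
  -- `γhi ≤ γhi r²/r₀²`
  have hγhir : γhi ≤ γhi / r₀ ^ 2 * r ^ 2 := by
    rw [div_mul_eq_mul_div, le_div_iff₀ hr₀2]
    exact mul_le_mul_of_nonneg_left hr2 hγhi0.le
  -- lower bound of `m = ω²r² − A`
  have hm_lb : (ω ^ 2 - γhi / r₀ ^ 2) * r ^ 2 ≤ ω ^ 2 * r ^ 2 - A := by nlinarith
  have hm_pos : 0 < ω ^ 2 * r ^ 2 - A := lt_of_lt_of_le (by positivity) hm_lb
  -- `c₁ = √(κ₀ γlo)`; lower bound `r c₁ ≤ Λ`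
  have hc₁ : 0 < Real.sqrt ((ω ^ 2 - γhi / r₀ ^ 2) * γlo) := Real.sqrt_pos.2 (mul_pos hκ hγlo)
  have hΛ_lb : r * Real.sqrt ((ω ^ 2 - γhi / r₀ ^ 2) * γlo) ≤ Λ := by
    have h1 : (r * Real.sqrt ((ω ^ 2 - γhi / r₀ ^ 2) * γlo)) ^ 2 ≤ Λ ^ 2 := by
      rw [mul_pow, Real.sq_sqrt (mul_pos hκ hγlo).le, hΛ2]
      have h2 : (ω ^ 2 - γhi / r₀ ^ 2) * r ^ 2 * γlo ≤ (ω ^ 2 * r ^ 2 - A) * A :=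
        mul_le_mul hm_lb hA1 hγlo.le hm_pos.le
      nlinarith
    exact (pow_le_pow_iff_left₀ (by positivity) hΛ.le two_ne_zero).1 h1
  -- upper bound `Λ ≤ |ω| r √γhi`
  have hΛ_ub : Λ ≤ |ω| * r * Real.sqrt γhi := by
    have h1 : Λ ^ 2 ≤ (|ω| * r * Real.sqrt γhi) ^ 2 := by
      rw [mul_pow, mul_pow, sq_abs, Real.sq_sqrt hγhi0.le, hΛ2]
      nlinarith
    exact (pow_le_pow_iff_left₀ hΛ.le (by positivity) two_ne_zero).1 h1
  -- numerator bound `|ω²r² − 2A| ≤ c₂ r²`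
  have hnum : |ω ^ 2 * r ^ 2 - 2 * A| ≤ (ω ^ 2 + 2 * γhi / r₀ ^ 2) * r ^ 2 := by
    have hexp : (ω ^ 2 + 2 * γhi / r₀ ^ 2) * r ^ 2 = ω ^ 2 * r ^ 2 + 2 * (γhi / r₀ ^ 2 * r ^ 2) := by ring
    have hωr : 0 ≤ ω ^ 2 * r ^ 2 := by positivity
    rw [abs_le, hexp]
    constructor
    · linarith
    · linarith
  -- rewrite the quantity
  have hrw : (τ * (ω ^ 2 * r ^ 2 - 2 * A) / (2 * Λ) * A - Λ * τ) / A ^ 2 =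
      τ * ((ω ^ 2 * r ^ 2 - 2 * A) / (2 * Λ * A) - Λ / A ^ 2) := by
    field_simp
  rw [hrw, abs_mul]
  -- the two pieces
  have hden : 0 < 2 * Λ * A := by positivity
  have hpiece1 : |(ω ^ 2 * r ^ 2 - 2 * A) / (2 * Λ * A)| ≤
      (ω ^ 2 + 2 * γhi / r₀ ^ 2) / (2 * Real.sqrt ((ω ^ 2 - γhi / r₀ ^ 2) * γlo) * γlo) * r := by
    rw [abs_div, abs_of_pos hden]
    have hden_lb : 2 * (r * Real.sqrt ((ω ^ 2 - γhi / r₀ ^ 2) * γlo)) * γlo ≤ 2 * Λ * A :=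
      mul_le_mul (mul_le_mul_of_nonneg_left hΛ_lb two_pos.le) hA1 hγlo.le (by positivity)
    have hden_lb_pos : 0 < 2 * (r * Real.sqrt ((ω ^ 2 - γhi / r₀ ^ 2) * γlo)) * γlo := by positivity
    calc |ω ^ 2 * r ^ 2 - 2 * A| / (2 * Λ * A)
        ≤ (ω ^ 2 + 2 * γhi / r₀ ^ 2) * r ^ 2 / (2 * (r * Real.sqrt ((ω ^ 2 - γhi / r₀ ^ 2) * γlo)) * γlo) :=
          div_le_div₀ (by positivity) hnum hden_lb_pos hden_lb
      _ = (ω ^ 2 + 2 * γhi / r₀ ^ 2) / (2 * Real.sqrt ((ω ^ 2 - γhi / r₀ ^ 2) * γlo) * γlo) * r := by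
          field_simp
  have hpiece2 : |Λ / A ^ 2| ≤ |ω| * Real.sqrt γhi / γlo ^ 2 * r := by
    rw [abs_div, abs_of_pos hΛ, abs_of_pos (by positivity : 0 < A ^ 2)]
    have hA2' : γlo ^ 2 ≤ A ^ 2 := pow_le_pow_left₀ hγlo.le hA1 2
    calc Λ / A ^ 2 ≤ (|ω| * r * Real.sqrt γhi) / γlo ^ 2 := div_le_div₀ (by positivity) hΛ_ub (by positivity) hA2'
      _ = |ω| * Real.sqrt γhi / γlo ^ 2 * r := by ring
  have hsum : |(ω ^ 2 * r ^ 2 - 2 * A) / (2 * Λ * A) - Λ / A ^ 2| ≤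
      ((ω ^ 2 + 2 * γhi / r₀ ^ 2) / (2 * Real.sqrt ((ω ^ 2 - γhi / r₀ ^ 2) * γlo) * γlo) +
        |ω| * Real.sqrt γhi / γlo ^ 2) * r := by
    calc |(ω ^ 2 * r ^ 2 - 2 * A) / (2 * Λ * A) - Λ / A ^ 2|
        ≤ |(ω ^ 2 * r ^ 2 - 2 * A) / (2 * Λ * A)| + |Λ / A ^ 2| := abs_sub _ _
      _ ≤ (ω ^ 2 + 2 * γhi / r₀ ^ 2) / (2 * Real.sqrt ((ω ^ 2 - γhi / r₀ ^ 2) * γlo) * γlo) * r +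
          |ω| * Real.sqrt γhi / γlo ^ 2 * r := add_le_add hpiece1 hpiece2
      _ = _ := by ring
  have hfac : 0 ≤ ((ω ^ 2 + 2 * γhi / r₀ ^ 2) / (2 * Real.sqrt ((ω ^ 2 - γhi / r₀ ^ 2) * γlo) * γlo) +
        |ω| * Real.sqrt γhi / γlo ^ 2) * r := by positivity
  calc |τ| * |(ω ^ 2 * r ^ 2 - 2 * A) / (2 * Λ * A) - Λ / A ^ 2|
      ≤ M * (((ω ^ 2 + 2 * γhi / r₀ ^ 2) / (2 * Real.sqrt ((ω ^ 2 - γhi / r₀ ^ 2) * γlo) * γlo) +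
        |ω| * Real.sqrt γhi / γlo ^ 2) * r) := mul_le_mul hτ hsum (abs_nonneg _) hM0
    _ = _ := by ring

/-! ### The turning rate `λ/γ(Ψ)` of the characteristics: size and angular derivative -/

/-- **Size of the turning rate.**  With `0 < γlo ≤ γ`, at every point `0 ≤ λ/γ(Ψ) ≤ |ω|‖y‖/√γlo`
(`λ = √((ω²‖y‖² − γ(Ψ))γ(Ψ)) ≤ |ω|‖y‖√γ(Ψ)`). [folklore] -/
theorem speed_le {γlo : ℝ} (hγlo : 0 < γlo) (hγlo' : ∀ s, γlo ≤ γ s) (y : EuclideanSpace ℝ (Fin 2)) :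
    0 ≤ Real.sqrt ((ω ^ 2 * ‖y‖ ^ 2 - γ (Ψ y)) * γ (Ψ y)) / γ (Ψ y) ∧
      Real.sqrt ((ω ^ 2 * ‖y‖ ^ 2 - γ (Ψ y)) * γ (Ψ y)) / γ (Ψ y) ≤ |ω| * ‖y‖ / Real.sqrt γlo := by
  have ha : 0 < γ (Ψ y) := hγlo.trans_le (hγlo' _)
  refine ⟨div_nonneg (Real.sqrt_nonneg _) ha.le, ?_⟩
  have h1 : Real.sqrt ((ω ^ 2 * ‖y‖ ^ 2 - γ (Ψ y)) * γ (Ψ y)) ≤ |ω| * ‖y‖ * Real.sqrt (γ (Ψ y)) := by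
    have h2 : (ω ^ 2 * ‖y‖ ^ 2 - γ (Ψ y)) * γ (Ψ y) ≤ (|ω| * ‖y‖ * Real.sqrt (γ (Ψ y))) ^ 2 := by
      rw [mul_pow, mul_pow, sq_abs, Real.sq_sqrt ha.le]
      nlinarith [sq_nonneg (γ (Ψ y))]
    exact Real.sqrt_le_iff.2 ⟨by positivity, h2⟩
  have h3 : Real.sqrt γlo ≤ Real.sqrt (γ (Ψ y)) := Real.sqrt_le_sqrt (hγlo' _)
  have h4 : 0 < Real.sqrt γlo := Real.sqrt_pos.2 hγlo
  have h5 : Real.sqrt (γ (Ψ y)) * Real.sqrt (γ (Ψ y)) = γ (Ψ y) := Real.mul_self_sqrt ha.le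
  calc Real.sqrt ((ω ^ 2 * ‖y‖ ^ 2 - γ (Ψ y)) * γ (Ψ y)) / γ (Ψ y)
      ≤ |ω| * ‖y‖ * Real.sqrt (γ (Ψ y)) / γ (Ψ y) := div_le_div_of_nonneg_right h1 ha.le
    _ = |ω| * ‖y‖ / Real.sqrt (γ (Ψ y)) := by
        rw [div_eq_div_iff ha.ne' (Real.sqrt_pos.2 ha).ne']
        linear_combination (|ω| * ‖y‖) * h5
    _ ≤ |ω| * ‖y‖ / Real.sqrt γlo := div_le_div_of_nonneg_left (by positivity) h4 h3

/-- **Bounded angular derivative of `γ(Ψ)` from angular flatness.**  If `|γ'| ≤ L` and `|DΨ(y)[Jy]| ≤ Q` (part I,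
`angularDeriv_abs_le_of_rotating`), then `|D(γ∘Ψ)(y)[Jy]| ≤ L·Q`. [folklore] -/
theorem angular_gamma_bound (hΨd : Differentiable ℝ Ψ) (hγ' : ∀ r, HasDerivAt γ (γ' r) r) {L Q : ℝ}
    (hL : ∀ r, |γ' r| ≤ L) (hQ : ∀ y, |fderiv ℝ Ψ y (J y)| ≤ Q) (y : EuclideanSpace ℝ (Fin 2)) :
    |fderiv ℝ (fun y' => γ (Ψ y')) y (J y)| ≤ L * Q := by
  rw [angular_chain hΨd hγ' y (J y), abs_mul]
  exact mul_le_mul (hL _) (hQ _) (abs_nonneg _) ((abs_nonneg _).trans (hL (Ψ y)))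

/-- **Angular derivative of the turning rate on a circle of the strict exterior.**  For `r ≥ r₀ > 0` with the margin `γhi < ω²r₀²`
and `γlo ≤ γ ≤ γhi`, `0 < γlo`, the function `α ↦ (λ/γ(Ψ))(P(r, α))` is differentiable with derivative
`(τ·(ω²r² − 2A)/(2Λ)·A − Λτ)/A²`, `A = γ(Ψ(P(r,α)))`, `Λ = √((ω²r² − A)A)`, `τ = D(γ∘Ψ)(P(r,α))[J P(r,α)]`. [folklore] -/
theorem hasDerivAt_speed_angle (hΨd : Differentiable ℝ Ψ) (hγd : Differentiable ℝ γ)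
    (hP : ∀ r α, P r α = (r * Real.cos α) • EuclideanSpace.single (0 : Fin 2) (1 : ℝ) + (r * Real.sin α) • EuclideanSpace.single (1 : Fin 2) (1 : ℝ))
    (hJ : ∀ y' : EuclideanSpace ℝ (Fin 2), J y' = (-(y' 1)) • EuclideanSpace.single (0 : Fin 2) (1 : ℝ) +
      (y' 0) • EuclideanSpace.single (1 : Fin 2) (1 : ℝ))
    {γlo γhi r₀ : ℝ} (hγlo : 0 < γlo) (hγlo' : ∀ s, γlo ≤ γ s) (hγhi : ∀ s, γ s ≤ γhi) (hr₀ : 0 < r₀)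
    (hmargin : γhi < ω ^ 2 * r₀ ^ 2) {r : ℝ} (hr : r₀ ≤ r) (α : ℝ) :
    HasDerivAt (fun α' => Real.sqrt ((ω ^ 2 * ‖P r α'‖ ^ 2 - γ (Ψ (P r α'))) * γ (Ψ (P r α'))) / γ (Ψ (P r α')))
      ((fderiv ℝ (fun y' => γ (Ψ y')) (P r α) (J (P r α)) * (ω ^ 2 * r ^ 2 - 2 * γ (Ψ (P r α))) /
          (2 * Real.sqrt ((ω ^ 2 * r ^ 2 - γ (Ψ (P r α))) * γ (Ψ (P r α)))) * γ (Ψ (P r α)) -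
        Real.sqrt ((ω ^ 2 * r ^ 2 - γ (Ψ (P r α))) * γ (Ψ (P r α))) * fderiv ℝ (fun y' => γ (Ψ y')) (P r α) (J (P r α))) /
        γ (Ψ (P r α)) ^ 2) α := by
  have hrpos : 0 < r := hr₀.trans_le hr
  have hγΨd : Differentiable ℝ fun y' => γ (Ψ y') := hγd.comp hΨd
  -- `‖P r α'‖² = r²`
  have hfun : (fun α' => Real.sqrt ((ω ^ 2 * ‖P r α'‖ ^ 2 - γ (Ψ (P r α'))) * γ (Ψ (P r α'))) / γ (Ψ (P r α'))) =
      fun α' => Real.sqrt ((ω ^ 2 * r ^ 2 - γ (Ψ (P r α'))) * γ (Ψ (P r α'))) / γ (Ψ (P r α')) := by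
    funext α'
    rw [norm_polar hP, sq_abs]
  rw [hfun]
  have hA : HasDerivAt (fun α' => γ (Ψ (P r α'))) (fderiv ℝ (fun y' => γ (Ψ y')) (P r α) (J (P r α))) α :=
    (hγΨd (P r α)).hasFDerivAt.comp_hasDerivAt α (hasDerivAt_polar_angle hP hJ r α)
  have hApos : 0 < γ (Ψ (P r α)) := hγlo.trans_le (hγlo' _)
  have hm_pos : 0 < ω ^ 2 * r ^ 2 - γ (Ψ (P r α)) := by
    have h1 : ω ^ 2 * r₀ ^ 2 ≤ ω ^ 2 * r ^ 2 := mul_le_mul_of_nonneg_left (pow_le_pow_left₀ hr₀.le hr 2) (sq_nonneg ω)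
    linarith [hγhi (Ψ (P r α))]
  have hprod_pos : 0 < (ω ^ 2 * r ^ 2 - γ (Ψ (P r α))) * γ (Ψ (P r α)) := mul_pos hm_pos hApos
  have hm : HasDerivAt (fun α' => ω ^ 2 * r ^ 2 - γ (Ψ (P r α'))) (0 - fderiv ℝ (fun y' => γ (Ψ y')) (P r α) (J (P r α))) α :=
    (hasDerivAt_const α (ω ^ 2 * r ^ 2)).sub hA
  have hprod := hm.mul hA
  have hsqrt := hprod.sqrt hprod_pos.ne'
  have hdiv := hsqrt.div hA hApos.ne'
  refine hdiv.congr_deriv ?_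
  simp only [Pi.mul_apply]
  ring

/-! ### The angle ODE of the characteristics: `ϑ'(r) = σ · (λ/γ(Ψ))(P(r, ϑ)) / r`, `σ = ∓1` -/

/-- **The angle field is bounded** by `|ω|/√γlo` for `r ≥ r₀ > 0`, `|σ| ≤ 1`. [folklore] -/
theorem angleField_bound
    (hP : ∀ r α, P r α = (r * Real.cos α) • EuclideanSpace.single (0 : Fin 2) (1 : ℝ) + (r * Real.sin α) • EuclideanSpace.single (1 : Fin 2) (1 : ℝ))
    {γlo r₀ σ : ℝ} (hγlo : 0 < γlo) (hγlo' : ∀ s, γlo ≤ γ s) (hr₀ : 0 < r₀) (hσ : |σ| ≤ 1) {r : ℝ} (hr : r₀ ≤ r) (α : ℝ) :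
    ‖σ * (Real.sqrt ((ω ^ 2 * ‖P r α‖ ^ 2 - γ (Ψ (P r α))) * γ (Ψ (P r α))) / γ (Ψ (P r α)) / r)‖ ≤ |ω| / Real.sqrt γlo := by
  have hrpos : 0 < r := hr₀.trans_le hr
  obtain ⟨h0, h1⟩ := speed_le (Ψ := Ψ) (ω := ω) hγlo hγlo' (P r α)
  rw [Real.norm_eq_abs, abs_mul, abs_div, abs_of_nonneg h0, abs_of_pos hrpos]
  have h2 : Real.sqrt ((ω ^ 2 * ‖P r α‖ ^ 2 - γ (Ψ (P r α))) * γ (Ψ (P r α))) / γ (Ψ (P r α)) / r ≤ |ω| / Real.sqrt γlo := by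
    rw [div_le_iff₀ hrpos]
    calc _ ≤ |ω| * ‖P r α‖ / Real.sqrt γlo := h1
      _ = |ω| / Real.sqrt γlo * r := by rw [norm_polar hP, abs_of_pos hrpos]; ring
  have h3 : 0 ≤ Real.sqrt ((ω ^ 2 * ‖P r α‖ ^ 2 - γ (Ψ (P r α))) * γ (Ψ (P r α))) / γ (Ψ (P r α)) / r := div_nonneg h0 hrpos.le
  calc |σ| * _ ≤ 1 * (|ω| / Real.sqrt γlo) := mul_le_mul hσ h2 h3 zero_le_one
    _ = _ := one_mul _

/-- **The angle field is continuous in the radius** on `[r₀, ∞)`, `r₀ > 0`. [folklore] -/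
theorem angleField_continuousOn (hΨc : Continuous Ψ) (hγc : Continuous γ)
    (hP : ∀ r α, P r α = (r * Real.cos α) • EuclideanSpace.single (0 : Fin 2) (1 : ℝ) + (r * Real.sin α) • EuclideanSpace.single (1 : Fin 2) (1 : ℝ))
    (hγpos : ∀ s, 0 < γ s) {r₀ : ℝ} (hr₀ : 0 < r₀) (σ α : ℝ) :
    ContinuousOn (fun r => σ * (Real.sqrt ((ω ^ 2 * ‖P r α‖ ^ 2 - γ (Ψ (P r α))) * γ (Ψ (P r α))) / γ (Ψ (P r α)) / r))
      (Ici r₀) := by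
  have hPc : Continuous fun r => P r α := by
    have hfun : (fun r => P r α) = fun r => (r * Real.cos α) • EuclideanSpace.single (0 : Fin 2) (1 : ℝ) +
        (r * Real.sin α) • EuclideanSpace.single (1 : Fin 2) (1 : ℝ) := funext fun r => hP r α
    rw [hfun]; fun_prop
  have hAc : Continuous fun r => γ (Ψ (P r α)) := hγc.comp (hΨc.comp hPc)
  have hnum : Continuous fun r => Real.sqrt ((ω ^ 2 * ‖P r α‖ ^ 2 - γ (Ψ (P r α))) * γ (Ψ (P r α))) / γ (Ψ (P r α)) :=
    (((continuous_const.mul (hPc.norm.pow 2)).sub hAc).mul hAc).sqrt.div hAc fun r => (hγpos _).ne'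
  refine continuousOn_const.mul (hnum.continuousOn.div continuousOn_id fun r hr => ?_)
  exact (hr₀.trans_le hr).ne'

/-- **The angle field is uniformly Lipschitz in the angle** for `r ≥ r₀` (strict exterior with margin, `γlo ≤ γ ≤ γhi`, bounded angular
derivative `|D(γ∘Ψ)(y)[Jy]| ≤ M`, `|σ| ≤ 1`): there is ONE constant `K` for all `r ≥ r₀`. [folklore] -/
theorem angleField_lipschitz (hΨd : Differentiable ℝ Ψ) (hγd : Differentiable ℝ γ)
    (hP : ∀ r α, P r α = (r * Real.cos α) • EuclideanSpace.single (0 : Fin 2) (1 : ℝ) + (r * Real.sin α) • EuclideanSpace.single (1 : Fin 2) (1 : ℝ))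
    (hJ : ∀ y' : EuclideanSpace ℝ (Fin 2), J y' = (-(y' 1)) • EuclideanSpace.single (0 : Fin 2) (1 : ℝ) +
      (y' 0) • EuclideanSpace.single (1 : Fin 2) (1 : ℝ))
    {γlo γhi r₀ M σ : ℝ} (hγlo : 0 < γlo) (hγlo' : ∀ s, γlo ≤ γ s) (hγhi : ∀ s, γ s ≤ γhi) (hr₀ : 0 < r₀)
    (hmargin : γhi < ω ^ 2 * r₀ ^ 2) (hτ : ∀ y, |fderiv ℝ (fun y' => γ (Ψ y')) y (J y)| ≤ M) (hσ : |σ| ≤ 1) :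
    ∃ K : ℝ≥0, ∀ r, r₀ ≤ r → LipschitzWith K
      (fun α => σ * (Real.sqrt ((ω ^ 2 * ‖P r α‖ ^ 2 - γ (Ψ (P r α))) * γ (Ψ (P r α))) / γ (Ψ (P r α)) / r)) := by
  set K₀ : ℝ := M * ((ω ^ 2 + 2 * γhi / r₀ ^ 2) / (2 * Real.sqrt ((ω ^ 2 - γhi / r₀ ^ 2) * γlo) * γlo) +
    |ω| * Real.sqrt γhi / γlo ^ 2) with hK₀
  have hM0 : 0 ≤ M := (abs_nonneg _).trans (hτ 0)
  have hγhi0 : 0 < γhi := (hγlo.trans_le (hγlo' 0)).trans_le (hγhi 0)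
  have hK₀0 : 0 ≤ K₀ := by positivity
  refine ⟨⟨K₀, hK₀0⟩, fun r hr => ?_⟩
  have hrpos : 0 < r := hr₀.trans_le hr
  -- the derivative of the field in the angle
  have hder : ∀ α, HasDerivAt
      (fun α => σ * (Real.sqrt ((ω ^ 2 * ‖P r α‖ ^ 2 - γ (Ψ (P r α))) * γ (Ψ (P r α))) / γ (Ψ (P r α)) / r))
      (σ * (((fderiv ℝ (fun y' => γ (Ψ y')) (P r α) (J (P r α)) * (ω ^ 2 * r ^ 2 - 2 * γ (Ψ (P r α))) /
          (2 * Real.sqrt ((ω ^ 2 * r ^ 2 - γ (Ψ (P r α))) * γ (Ψ (P r α)))) * γ (Ψ (P r α)) -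
        Real.sqrt ((ω ^ 2 * r ^ 2 - γ (Ψ (P r α))) * γ (Ψ (P r α))) * fderiv ℝ (fun y' => γ (Ψ y')) (P r α) (J (P r α))) /
        γ (Ψ (P r α)) ^ 2) / r)) α := fun α =>
    ((hasDerivAt_speed_angle (ω := ω) hΨd hγd hP hJ hγlo hγlo' hγhi hr₀ hmargin hr α).div_const r).const_mul σ
  refine lipschitzWith_of_nnnorm_deriv_le (fun α => (hder α).differentiableAt) fun α => ?_
  rw [(hder α).deriv]
  -- the scalar kernel
  have hApos : 0 < γ (Ψ (P r α)) := hγlo.trans_le (hγlo' _)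
  have hm_pos : 0 < ω ^ 2 * r ^ 2 - γ (Ψ (P r α)) := by
    have h1 : ω ^ 2 * r₀ ^ 2 ≤ ω ^ 2 * r ^ 2 := mul_le_mul_of_nonneg_left (pow_le_pow_left₀ hr₀.le hr 2) (sq_nonneg ω)
    linarith [hγhi (Ψ (P r α))]
  have hΛ : 0 < Real.sqrt ((ω ^ 2 * r ^ 2 - γ (Ψ (P r α))) * γ (Ψ (P r α))) := Real.sqrt_pos.2 (mul_pos hm_pos hApos)
  have hΛ2 : Real.sqrt ((ω ^ 2 * r ^ 2 - γ (Ψ (P r α))) * γ (Ψ (P r α))) ^ 2 = (ω ^ 2 * r ^ 2 - γ (Ψ (P r α))) * γ (Ψ (P r α)) :=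
    Real.sq_sqrt (mul_pos hm_pos hApos).le
  have hk := angle_speed_deriv_le hγlo (hγlo' _) (hγhi _) hr₀ hr hmargin hΛ hΛ2 (hτ (P r α))
  have hbound : ‖σ * (((fderiv ℝ (fun y' => γ (Ψ y')) (P r α) (J (P r α)) * (ω ^ 2 * r ^ 2 - 2 * γ (Ψ (P r α))) /
          (2 * Real.sqrt ((ω ^ 2 * r ^ 2 - γ (Ψ (P r α))) * γ (Ψ (P r α)))) * γ (Ψ (P r α)) -
        Real.sqrt ((ω ^ 2 * r ^ 2 - γ (Ψ (P r α))) * γ (Ψ (P r α))) * fderiv ℝ (fun y' => γ (Ψ y')) (P r α) (J (P r α))) /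
        γ (Ψ (P r α)) ^ 2) / r)‖ ≤ K₀ := by
    rw [Real.norm_eq_abs, abs_mul, abs_div, abs_of_pos hrpos]
    have h1 : |((fderiv ℝ (fun y' => γ (Ψ y')) (P r α) (J (P r α)) * (ω ^ 2 * r ^ 2 - 2 * γ (Ψ (P r α))) /
          (2 * Real.sqrt ((ω ^ 2 * r ^ 2 - γ (Ψ (P r α))) * γ (Ψ (P r α)))) * γ (Ψ (P r α)) -
        Real.sqrt ((ω ^ 2 * r ^ 2 - γ (Ψ (P r α))) * γ (Ψ (P r α))) * fderiv ℝ (fun y' => γ (Ψ y')) (P r α) (J (P r α))) /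
        γ (Ψ (P r α)) ^ 2)| / r ≤ K₀ := by
      rw [div_le_iff₀ hrpos, hK₀]
      exact hk
    calc _ ≤ 1 * K₀ := mul_le_mul hσ h1 (by positivity) zero_le_one
      _ = K₀ := one_mul _
  have h' : (‖σ * (((fderiv ℝ (fun y' => γ (Ψ y')) (P r α) (J (P r α)) * (ω ^ 2 * r ^ 2 - 2 * γ (Ψ (P r α))) /
          (2 * Real.sqrt ((ω ^ 2 * r ^ 2 - γ (Ψ (P r α))) * γ (Ψ (P r α)))) * γ (Ψ (P r α)) -
        Real.sqrt ((ω ^ 2 * r ^ 2 - γ (Ψ (P r α))) * γ (Ψ (P r α))) * fderiv ℝ (fun y' => γ (Ψ y')) (P r α) (J (P r α))) /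
        γ (Ψ (P r α)) ^ 2) / r)‖₊ : ℝ) ≤ ((⟨K₀, hK₀0⟩ : ℝ≥0) : ℝ) := by
    rw [coe_nnnorm]
    exact hbound
  exact NNReal.coe_le_coe.1 h'

end Summit.NavierStokesRegularity.NavierStokesRegularity.Theorems.PoloidalWindowDoorPoloidalWindowRigidityZShockRotatingProfileAngleField
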